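import Summits.BirchSwinnertonDyer.BirchSwinnertonDyer.Theorems.ByReductionTypeAtTwoOrdKatoHalfAtTwoIsoConjATwoOfNarrowRankLayerTwo
import Literature.NumberTheory.IwasawaTheory.NarrowFukudaCertificateLayerPolynomialModels
import Literature.NumberTheory.IwasawaTheory.NarrowFukudaCertificateCompletenessCyclotomic
import HarnessLib

/-!
# Route `ByReductionTypeAtTwo`, crux `OrdKatoHalfAtTwoIso` (stmt-BirchSwinnertonDyer-19573), the `0 < Δ` cell: Coates–Sujatha's (A) at `2` from
# ANY RUNG `m ≥ 1` of the narrow rank certificate of the cubic point field — `rank₂ Cl⁺(ℚ(P)_{m+1}) = rank₂ Cl⁺(ℚ(P)_m)` — abstract layers, or the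
# CONCRETE MODELS `ℚ(P)_m ≅ ℚ(P)(θ_m)`, `Ψ_m(θ_m) = 0` (`Ψ_1 = X² − 2`, `Ψ_2 = X⁴ − 4X² + 2`, `Ψ_3 = X⁸ − 8X⁶ + 20X⁴ − 16X² + 2`, `Ψ_{m+1} = Ψ_m² − 2`)

`--supports stmt-BirchSwinnertonDyer-19573` file of the width seat `cruxlead-stmt-BirchSwinnertonDyer-19573-w2` GEN 11 (cell `bsd-2adic`). THEOREMS ONLY
(no definition, no named fact, no `sorry`). Closes nothing: Q⁺, G11⁺ and the crux remain OPEN; no certificate is asserted for any curve here; BSD is not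
proved by any of this.

WHAT. GEN 9/10's doors read NARROW FUKUDA at the rungs `m = 0` (`…ConjATwoOfNarrowRankCertificate` §4: index `0` + `rank₂ Cl⁺(ℚ(P)(√2)) = rank₂ Cl⁺(ℚ(P))`)
and `m = 1` (`…ConjATwoOfNarrowRankLayerTwo`: `rank₂ Cl⁺(ℚ(P)(√(2+√2))) = rank₂ Cl⁺(ℚ(P)(√2))`, no other hypothesis).  When the narrow `2`-rank of the cubic
tower `ℚ(P)_j` grows at BOTH pairs `(0,1)` and `(1,2)` the next rungs are needed; this file wires the generic Literature certificate of this seat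
(`NarrowFukudaCertificateLayerPolynomialModels`: `NarrowFukuda.narrowMu_of_index_le_of_succ_eq` — abstract layers, uniform narrow-defect bound —, and
`NarrowFukuda.narrowMu_of_layer_models_of_finrank_eq_three` — cubic `K`, ANY `m ≥ 1`, models `L ≅ K_m` of degree `2^m` with a root of `Ψ_m` and `L' ≅ K_{m+1}`,
ONE equality `[Cl⁺(L') : Cl⁺(L')²] = [Cl⁺(L) : Cl⁺(L)²]`) into GEN 8's Kida-lite road (`NarrowMu.conjA_two_of_narrowMu_pointField`,
`NarrowMu.conjA_two_cubicModel_of_narrowMu`).  «`θ` is a root of `Ψ_m`» is written `(fun x => x ^ 2 - 2)^[m] θ = 0` (no new definition).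

* §1 **`conjA_two_of_narrowRank_layer_succ_eq_pointField`** — (A) at `(W, 2)` (`∃ γ Dd` form, every cyclotomic `κ` of `ℚ`) for `P ∈ W[2] ∖ 0` with `[ℚ(P) : ℚ] = 3`,
  from ONE equality `rank₂ Cl⁺(ℚ(P)_{m+1}) = rank₂ Cl⁺(ℚ(P)_m)` at SOME `m ≥ 1` (abstract layers of every cyclotomic `ℤ₂`-extension of `ℚ(P)`); and
  **`conjA_two_of_narrowRank_layer_models_eq_pointField`** — the same with concrete models `L ≅ ℚ(P)_m`, `L' ≅ ℚ(P)_{m+1}`.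
* §2 ★ **`conjA_two_cubicModel_of_narrowRank_layer_succ_eq`** — the CUBIC-MODEL door in the census currency of C1″/C4″/k4 (`y² = x³ + px² + qx + r`, irreducible,
  `β` a root), ANY rung `m ≥ 1`, ABSTRACT layers (`rank₂ Cl⁺(κP.layer (m+1)) = rank₂ Cl⁺(κP.layer m)` for every cyclotomic `κP` of `ℚ(β)`; the shape of k4's
  `conjA_two_<L>_of_narrowRankEq₁₂` instances); ★ **`conjA_two_cubicModel_of_narrowRank_layer_models_eq`** — the same with CONCRETE models `L ⊇ ℚ(β)` of degree `2^m` with a root of `Ψ_m`, `L' ⊇ ℚ(β)` of degree `2^{m+1}` with a root of `Ψ_{m+1}`, and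
  `[Cl⁺(L') : Cl⁺(L')²] = [Cl⁺(L) : Cl⁺(L)²]` ⟹ (A)₂ for `⟨0, p, 0, q, r⟩` at every cyclotomic `κ` — NO OTHER HYPOTHESIS; ★ **`conjA_two_cubicModel_of_narrowRank_layerThree_eq`**
  — the rung `m = 2` spelled out: `[L₂ : ℚ(β)] = 4`, `θ₂⁴ − 4θ₂² + 2 = 0`; `[L₃ : ℚ(β)] = 8`, `θ₃⁸ − 8θ₃⁶ + 20θ₃⁴ − 16θ₃² + 2 = 0` (degrees `12` and `24` over `ℚ`:
  the `k_2`, `k_3` rows of a `bnfnarrow` table).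
* §3 ★ **`fineSelmerConjATwoOrdPosDisc_of_exists_narrowRank_layer_succ_eq`** — the Q⁺ ROAD: if at every curve of the cell [non-CM, analytic rank `0`, good ordinary at `2`,
  `ρ̄_{W,2}` onto, `0 < Δ`] SOME `P ∈ W[2] ∖ 0` and SOME `m ≥ 1` have `rank₂ Cl⁺(ℚ(P)_{m+1}) = rank₂ Cl⁺(ℚ(P)_m)` along every cyclotomic `ℤ₂`-extension of `ℚ(P)`,
  then `FineSelmerConjATwoOrdPosDisc`.  Since the narrow `2`-ranks of a totally-ramified-from-`1` tower are eventually constant exactly when the narrow Iwasawa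
  module has `μ = 0` (Fukuda), this prices Q⁺ as «the narrow `2`-rank of `ℚ(P)_j` stops growing at some consecutive pair `j = m, m+1 ≥ 1`» — one finite datum per curve.

* §4 (GEN 11 append) `narrowMu_pointField_iff_exists_narrowRank_layer_succ_eq`, ★ **`hIw_narrowMu_pointField_iff_hIw_exists_narrowRank_layer_succ_eq`** — the hypothesis of
  GEN 8's Q⁺ road (`NarrowMu.fineSelmerConjATwoOrdPosDisc_of_narrowMu_pointField`) and that of §3's Q⁺ road are EQUIVALENT: one road, priced as «the narrow `2`-rank of the cubic
  tower `ℚ(P)_j` stops growing at some consecutive pair `j ≥ 1`» (Literature `NarrowFukuda.narrowMu_iff_exists_succ_eq_of_finrank_eq_three`: narrow Fukuda one way, rank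
  monotonicity and `rank₂ Cl⁺ ≤ rank₂ Cl +` narrow defect the other).

* §5 (GEN 11 append) `conjA_two_cubicModel_of_index_le_of_narrowRank_layer_succ_eq` (any `m ≥ 0` with an explicit Fukuda index `≤ m`; no bound `B`),
  `conjA_two_cubicModel_of_not_dvd_discr_of_narrowRank_layer_one_eq` (rung `0` for `2 ∤ disc`).

Honest scope: a property of the number field `ℚ(P)` is consumed, nothing is asserted about any field or curve; failure of every rung up to `m` does not refute
narrow `μ₂ = 0` (Greenberg-conjecture territory for the cubic).

References: [Fukuda1994] Thm. 1 (2), p. 264; [Washington1997] §13.1 (`ℚ_n = ℚ(ζ_{2^{n+2}})⁺`, `K_n = Kℚ_n`), Lemma 13.3; [Kida1982JFields] (μ-part; shape);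
[CoatesSujatha2005] Conj. A, Thm. 3.4; [Lim2017FineSelmer] §3 Thm. 3.5 / Lemma 3.2; [GreenbergLNM1716] p. 122, Conj. 1.11; tree p744372 (GEN 10), p740352 (GEN 9),
p734566 (GEN 8).
-/

set_option autoImplicit false
-- sibling precedent (`…ConjATwoOfNarrowRankLayerTwo.lean`): the directory name repeats the summit name
set_option linter.dupNamespace false

noncomputable section

open scoped Classical NumberField IntermediateField Polynomial

namespace Summit.BirchSwinnertonDyer.BirchSwinnertonDyer.Theorems.SteinbergFibreAtTwo.NarrowRankRung

open WeierstrassCurve NumberField IsDedekindDomain Field Polynomial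
open Literature.NumberTheory.EllipticCurves Literature.NumberTheory.EllipticCurves.ZpExtension
  Literature.NumberTheory.GaloisRepresentations Literature.NumberTheory.IwasawaTheory Literature.NumberTheory.NumberFields
  Literature.NumberTheory.EllipticCurves.Rank1Residual
open Summit.BirchSwinnertonDyer.BirchSwinnertonDyer.Theorems.AlignedTransportAtTwoTorsionPointField
open Summit.BirchSwinnertonDyer.BirchSwinnertonDyer.Theorems.SteinbergFibreAtTwo
open Summit.BirchSwinnertonDyer.BirchSwinnertonDyer.Theses.ByReductionTypeAtTwo

/-! ## §1 Statement (A) at `(W, 2)` from the rung `m` of the narrow rank certificate of a cubic point field — ANY sign of `Δ` -/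

section PointField

variable (W : WeierstrassCurve ℚ) [W.IsElliptic]

/-- **(A) at `(W, 2)` from ONE equality `rank₂ Cl⁺(ℚ(P)_{m+1}) = rank₂ Cl⁺(ℚ(P)_m)`, `m ≥ 1`, abstract layers** (`W/ℚ` elliptic, `P ∈ W[2] ∖ 0`, `[ℚ(P) : ℚ] = 3`):
if every cyclotomic `ℤ₂`-extension `κP` of `ℚ(P) = ℚ̄^{Stab P}` has `[Cl⁺(κP.layer (m+1)) : (Cl⁺)²] = [Cl⁺(κP.layer m) : (Cl⁺)²]` (any `NumberField` instances), then
for every cyclotomic `ℤ₂`-extension `κ` of `ℚ` some `FineSelmerDualData` of `W` has `X` finitely generated over `ℤ₂`.  The cubic `ℚ(P)` has Fukuda index `≤ 1 ≤ m`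
(`forall_totallyRamifiedFrom_one_of_finrank_eq_three`); `NarrowFukuda.narrowMu_of_index_le_of_succ_eq` gives (a) ∧ (b) with a uniform `D`; then GEN 8's
`NarrowMu.conjA_two_of_narrowMu_pointField`. [cite: Fukuda1994, Thm. 1 (2), p. 264] [cite: Washington1997, §13.1 and Lemma 13.3] [cite: CoatesSujatha2005, Conj. A and Thm. 3.4] -/
theorem conjA_two_of_narrowRank_layer_succ_eq_pointField {P : geomTorsion W 2} (hP : P ≠ 0)
    (h3 : Module.finrank ℚ ↥(IntermediateField.fixedField (MulAction.stabilizer (absoluteGaloisGroup ℚ) P)) = 3)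
    [NumberField ↥(IntermediateField.fixedField (MulAction.stabilizer (absoluteGaloisGroup ℚ) P))]
    (m : ℕ) (hm : 1 ≤ m)
    (hcert : ∀ κP : ZpExtension ↥(IntermediateField.fixedField (MulAction.stabilizer (absoluteGaloisGroup ℚ) P)) 2,
      κP.IsCyclotomic → ∀ [NumberField ↥(κP.layer m)] [NumberField ↥(κP.layer (m + 1))],
        (powMonoidHom (α := NarrowClassGroup ↥(κP.layer (m + 1))) 2).range.index =
          (powMonoidHom (α := NarrowClassGroup ↥(κP.layer m)) 2).range.index)
    (κ : ZpExtension ℚ 2) (hκ : κ.IsCyclotomic) :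
    ∃ (γ : absoluteGaloisGroup ℚ) (Dd : W.FineSelmerDualData κ γ),
      Module.Finite ℤ_[2] (RestrictScalars ℤ_[2] (IwasawaAlgebra 2) Dd.X) := by
  haveI : Fact (Nat.Prime 2) := ⟨Nat.prime_two⟩
  obtain ⟨hμ, D, hδ⟩ := NarrowFukuda.narrowMu_of_index_le_of_succ_eq
    (↥(IntermediateField.fixedField (MulAction.stabilizer (absoluteGaloisGroup ℚ) P))) m
    (fun κP hκP => (forall_totallyRamifiedFrom_one_of_finrank_eq_three h3 κP hκP).mono hm) hcert
  exact NarrowMu.conjA_two_of_narrowMu_pointField W hP (by rw [h3]; decide) hμ D hδ κ hκ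

/-- **(A) at `(W, 2)` from the rung `m ≥ 1` with CONCRETE MODELS** (`W/ℚ` elliptic, `P ∈ W[2] ∖ 0`, `[ℚ(P) : ℚ] = 3`): `L/ℚ(P)` of degree `2^m` with a root `θ` of `Ψ_m`
(a model of `ℚ(P)_m`), `L'/ℚ(P)` of degree `2^{m+1}` with a root `θ'` of `Ψ_{m+1}` (a model of `ℚ(P)_{m+1}`), and `[Cl⁺(L') : Cl⁺(L')²] = [Cl⁺(L) : Cl⁺(L)²]` ⟹ for every
cyclotomic `ℤ₂`-extension `κ` of `ℚ` some `FineSelmerDualData` of `W` has `X` finitely generated over `ℤ₂`.  `NarrowFukuda.narrowMu_of_layer_models_of_finrank_eq_three`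
+ GEN 8's `NarrowMu.conjA_two_of_narrowMu_pointField`. [cite: Fukuda1994, Thm. 1 (2), p. 264] [cite: Washington1997, §13.1 and Lemma 13.3] [cite: CoatesSujatha2005, Conj. A and Thm. 3.4] -/
theorem conjA_two_of_narrowRank_layer_models_eq_pointField {P : geomTorsion W 2} (hP : P ≠ 0)
    (h3 : Module.finrank ℚ ↥(IntermediateField.fixedField (MulAction.stabilizer (absoluteGaloisGroup ℚ) P)) = 3)
    [NumberField ↥(IntermediateField.fixedField (MulAction.stabilizer (absoluteGaloisGroup ℚ) P))]
    (m : ℕ) (hm : 1 ≤ m)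
    (L : Type) [Field L] [NumberField L] [Algebra ↥(IntermediateField.fixedField (MulAction.stabilizer (absoluteGaloisGroup ℚ) P)) L]
    (hL : Module.finrank ↥(IntermediateField.fixedField (MulAction.stabilizer (absoluteGaloisGroup ℚ) P)) L = 2 ^ m) (θ : L)
    (hθ : (fun x : L => x ^ 2 - 2)^[m] θ = 0)
    (L' : Type) [Field L'] [NumberField L'] [Algebra ↥(IntermediateField.fixedField (MulAction.stabilizer (absoluteGaloisGroup ℚ) P)) L']
    (hL' : Module.finrank ↥(IntermediateField.fixedField (MulAction.stabilizer (absoluteGaloisGroup ℚ) P)) L' = 2 ^ (m + 1)) (θ' : L')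
    (hθ' : (fun x : L' => x ^ 2 - 2)^[m + 1] θ' = 0)
    (hr : (powMonoidHom (α := NarrowClassGroup L') 2).range.index = (powMonoidHom (α := NarrowClassGroup L) 2).range.index)
    (κ : ZpExtension ℚ 2) (hκ : κ.IsCyclotomic) :
    ∃ (γ : absoluteGaloisGroup ℚ) (Dd : W.FineSelmerDualData κ γ),
      Module.Finite ℤ_[2] (RestrictScalars ℤ_[2] (IwasawaAlgebra 2) Dd.X) := by
  obtain ⟨hμ, D, hδ⟩ := NarrowFukuda.narrowMu_of_layer_models_of_finrank_eq_three
    (↥(IntermediateField.fixedField (MulAction.stabilizer (absoluteGaloisGroup ℚ) P))) h3 m hm L hL θ hθ L' hL' θ' hθ' hr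
  exact NarrowMu.conjA_two_of_narrowMu_pointField W hP (by rw [h3]; decide) hμ D hδ κ hκ

end PointField

/-! ## §2 The cubic-model doors at the rung `m` (census currency of C1″ / C4″ / k4: `y² = x³ + px² + qx + r`, `β` a root) -/

/-- ★ **(A) at `2` for `y² = x³ + px² + qx + r` (irreducible, `β` a root) from ONE equality `rank₂ Cl⁺(ℚ(β)_{m+1}) = rank₂ Cl⁺(ℚ(β)_m)`, `m ≥ 1`, ABSTRACT
LAYERS — NO OTHER HYPOTHESIS.**  If every cyclotomic `ℤ₂`-extension `κP` of the cubic field `ℚ(β)` has `[Cl⁺(κP.layer (m+1)) : (Cl⁺)²] = [Cl⁺(κP.layer m) : (Cl⁺)²]`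
(any `NumberField` instances on the layers), then (A)₂ holds for `⟨0, p, 0, q, r⟩` at every cyclotomic `κ` of `ℚ`.  The census instance shape of k4's
`conjA_two_<L>_of_narrowRankEq₁₂` at a general rung (Fukuda index `≤ 1 ≤ m` is automatic for the cubic `ℚ(β)`).  Nothing is asserted about any curve.
[cite: Fukuda1994, Thm. 1 (2), p. 264] [cite: Washington1997, §13.1 and Lemma 13.3] [cite: CoatesSujatha2005, Conj. A and Thm. 3.4] -/
theorem conjA_two_cubicModel_of_narrowRank_layer_succ_eq (p q r : ℤ)
    [((⟨0, (p : ℚ), 0, (q : ℚ), (r : ℚ)⟩ : WeierstrassCurve ℚ)).IsElliptic]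
    (hirr : Irreducible (Cubic.toPoly ⟨1, (p : ℚ), q, r⟩))
    {β : AlgebraicClosure ℚ} (hβ : aeval β (Cubic.toPoly ⟨1, (p : ℚ), q, r⟩) = 0)
    [NumberField ↥(IntermediateField.adjoin ℚ ({β} : Set (AlgebraicClosure ℚ)))]
    (m : ℕ) (hm : 1 ≤ m)
    (hcert : ∀ κP : ZpExtension ↥(IntermediateField.adjoin ℚ ({β} : Set (AlgebraicClosure ℚ))) 2, κP.IsCyclotomic →
      ∀ [NumberField ↥(κP.layer m)] [NumberField ↥(κP.layer (m + 1))],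
        (powMonoidHom (α := NarrowClassGroup ↥(κP.layer (m + 1))) 2).range.index =
          (powMonoidHom (α := NarrowClassGroup ↥(κP.layer m)) 2).range.index)
    (κ : ZpExtension ℚ 2) (hκ : κ.IsCyclotomic) :
    ∃ (γ : absoluteGaloisGroup ℚ) (Dd : ((⟨0, (p : ℚ), 0, (q : ℚ), (r : ℚ)⟩ : WeierstrassCurve ℚ)).FineSelmerDualData κ γ),
      Module.Finite ℤ_[2] (RestrictScalars ℤ_[2] (IwasawaAlgebra 2) Dd.X) := by
  haveI : Fact (Nat.Prime 2) := ⟨Nat.prime_two⟩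
  have hmonic : (Cubic.toPoly ⟨1, (p : ℚ), q, r⟩).Monic := Cubic.monic_of_a_eq_one rfl
  have hβint : IsIntegral ℚ β := ⟨_, hmonic, by rwa [← aeval_def]⟩
  have h3 : Module.finrank ℚ ↥(IntermediateField.adjoin ℚ ({β} : Set (AlgebraicClosure ℚ))) = 3 := by
    rw [IntermediateField.adjoin.finrank hβint, ← minpoly.eq_of_irreducible_of_monic hirr hβ hmonic]
    exact Cubic.natDegree_of_a_ne_zero' one_ne_zero
  obtain ⟨hμ, D, hδ⟩ := NarrowFukuda.narrowMu_of_index_le_of_succ_eq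
    (↥(IntermediateField.adjoin ℚ ({β} : Set (AlgebraicClosure ℚ)))) m
    (fun κP hκP => (forall_totallyRamifiedFrom_one_of_finrank_eq_three h3 κP hκP).mono hm) hcert
  exact NarrowMu.conjA_two_cubicModel_of_narrowMu p q r hirr hβ hμ D hδ κ hκ

/-- ★ **(A) at `2` for `y² = x³ + px² + qx + r` (irreducible, `β` a root) from ONE equality of narrow `2`-ranks at the rung `m ≥ 1`, CONCRETE MODELS — NO OTHER
HYPOTHESIS.**
Models: `L ⊇ ℚ(β)` with `[L : ℚ(β)] = 2^m` and a root `θ` of `Ψ_m` (`(fun x => x ^ 2 - 2)^[m] θ = 0`; a model of `ℚ(β)_m`), `L' ⊇ ℚ(β)` with `[L' : ℚ(β)] = 2^{m+1}` and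
a root `θ'` of `Ψ_{m+1}`; `[Cl⁺(L') : Cl⁺(L')²] = [Cl⁺(L) : Cl⁺(L)²]` ⟹ (A)₂ for `⟨0, p, 0, q, r⟩` at every cyclotomic `κ` of `ℚ`.  The cubic `ℚ(β)` has Fukuda index
`≤ 1` for every cyclotomic `ℤ₂`-extension, so no ramification datum is needed — any discriminant sign, any behaviour of `2`.  One finite datum per curve and rung:
the narrow `2`-ranks of two explicit fields of degrees `3·2^m` and `3·2^{m+1}`.  Rungs `m = 0, 1` are GEN 9/10's `conjA_two_cubicModel_of_narrowRank_sqrtTwo_model`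
(index `0` needed) and `conjA_two_cubicModel_of_narrowRank_layerTwo_eq`.  Nothing is asserted about any curve.
[cite: Fukuda1994, Thm. 1 (2), p. 264] [cite: Washington1997, §13.1 and Lemma 13.3] [cite: CoatesSujatha2005, Conj. A and Thm. 3.4] -/
theorem conjA_two_cubicModel_of_narrowRank_layer_models_eq (p q r : ℤ)
    [((⟨0, (p : ℚ), 0, (q : ℚ), (r : ℚ)⟩ : WeierstrassCurve ℚ)).IsElliptic]
    (hirr : Irreducible (Cubic.toPoly ⟨1, (p : ℚ), q, r⟩))
    {β : AlgebraicClosure ℚ} (hβ : aeval β (Cubic.toPoly ⟨1, (p : ℚ), q, r⟩) = 0)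
    [NumberField ↥(IntermediateField.adjoin ℚ ({β} : Set (AlgebraicClosure ℚ)))]
    (m : ℕ) (hm : 1 ≤ m)
    (L : Type) [Field L] [NumberField L] [Algebra ↥(IntermediateField.adjoin ℚ ({β} : Set (AlgebraicClosure ℚ))) L]
    (hL : Module.finrank ↥(IntermediateField.adjoin ℚ ({β} : Set (AlgebraicClosure ℚ))) L = 2 ^ m) (θ : L)
    (hθ : (fun x : L => x ^ 2 - 2)^[m] θ = 0)
    (L' : Type) [Field L'] [NumberField L'] [Algebra ↥(IntermediateField.adjoin ℚ ({β} : Set (AlgebraicClosure ℚ))) L']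
    (hL' : Module.finrank ↥(IntermediateField.adjoin ℚ ({β} : Set (AlgebraicClosure ℚ))) L' = 2 ^ (m + 1)) (θ' : L')
    (hθ' : (fun x : L' => x ^ 2 - 2)^[m + 1] θ' = 0)
    (hr : (powMonoidHom (α := NarrowClassGroup L') 2).range.index = (powMonoidHom (α := NarrowClassGroup L) 2).range.index)
    (κ : ZpExtension ℚ 2) (hκ : κ.IsCyclotomic) :
    ∃ (γ : absoluteGaloisGroup ℚ) (Dd : ((⟨0, (p : ℚ), 0, (q : ℚ), (r : ℚ)⟩ : WeierstrassCurve ℚ)).FineSelmerDualData κ γ),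
      Module.Finite ℤ_[2] (RestrictScalars ℤ_[2] (IwasawaAlgebra 2) Dd.X) := by
  have hmonic : (Cubic.toPoly ⟨1, (p : ℚ), q, r⟩).Monic := Cubic.monic_of_a_eq_one rfl
  have hβint : IsIntegral ℚ β := ⟨_, hmonic, by rwa [← aeval_def]⟩
  have h3 : Module.finrank ℚ ↥(IntermediateField.adjoin ℚ ({β} : Set (AlgebraicClosure ℚ))) = 3 := by
    rw [IntermediateField.adjoin.finrank hβint, ← minpoly.eq_of_irreducible_of_monic hirr hβ hmonic]
    exact Cubic.natDegree_of_a_ne_zero' one_ne_zero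
  obtain ⟨hμ, D, hδ⟩ := NarrowFukuda.narrowMu_of_layer_models_of_finrank_eq_three
    (↥(IntermediateField.adjoin ℚ ({β} : Set (AlgebraicClosure ℚ)))) h3 m hm L hL θ hθ L' hL' θ' hθ' hr
  exact NarrowMu.conjA_two_cubicModel_of_narrowMu p q r hirr hβ hμ D hδ κ hκ

/-- ★ **THE RUNG `m = 2` IN THE CENSUS CURRENCY: (A) at `2` for `y² = x³ + px² + qx + r` (irreducible, `β` a root) from
`rank₂ Cl⁺(ℚ(β)(θ₃)) = rank₂ Cl⁺(ℚ(β)(θ₂))`, `θ₂⁴ − 4θ₂² + 2 = 0`, `θ₃⁸ − 8θ₃⁶ + 20θ₃⁴ − 16θ₃² + 2 = 0` — NO OTHER HYPOTHESIS.**  Models: `L₂ ⊇ ℚ(β)` with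
`[L₂ : ℚ(β)] = 4` and a root `θ₂` of `X⁴ − 4X² + 2` (`ℚ(β)_2 = ℚ(β)(√(2+√2))`, degree `12`); `L₃ ⊇ ℚ(β)` with `[L₃ : ℚ(β)] = 8` and a root `θ₃` of
`X⁸ − 8X⁶ + 20X⁴ − 16X² + 2` (`ℚ(β)_3 = ℚ(β)(2cos(π/16))`, degree `24`); `[Cl⁺(L₃) : Cl⁺(L₃)²] = [Cl⁺(L₂) : Cl⁺(L₂)²]` ⟹ (A)₂ for `⟨0, p, 0, q, r⟩` at every
cyclotomic `κ`.  The rung for rows whose narrow `2`-rank grows at the layer pairs `(0,1)` and `(1,2)` (letters JUMP₀₁, JUMP₁₂ of a `bnfnarrow` census).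
Nothing is asserted about any curve. [cite: Fukuda1994, Thm. 1 (2), p. 264] [cite: Washington1997, §13.1 and Lemma 13.3] [cite: CoatesSujatha2005, Conj. A and Thm. 3.4] -/
theorem conjA_two_cubicModel_of_narrowRank_layerThree_eq (p q r : ℤ)
    [((⟨0, (p : ℚ), 0, (q : ℚ), (r : ℚ)⟩ : WeierstrassCurve ℚ)).IsElliptic]
    (hirr : Irreducible (Cubic.toPoly ⟨1, (p : ℚ), q, r⟩))
    {β : AlgebraicClosure ℚ} (hβ : aeval β (Cubic.toPoly ⟨1, (p : ℚ), q, r⟩) = 0)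
    [NumberField ↥(IntermediateField.adjoin ℚ ({β} : Set (AlgebraicClosure ℚ)))]
    (L₂ : Type) [Field L₂] [NumberField L₂] [Algebra ↥(IntermediateField.adjoin ℚ ({β} : Set (AlgebraicClosure ℚ))) L₂]
    (hL₂ : Module.finrank ↥(IntermediateField.adjoin ℚ ({β} : Set (AlgebraicClosure ℚ))) L₂ = 4) (θ₂ : L₂)
    (hθ₂ : θ₂ ^ 4 - 4 * θ₂ ^ 2 + 2 = 0)
    (L₃ : Type) [Field L₃] [NumberField L₃] [Algebra ↥(IntermediateField.adjoin ℚ ({β} : Set (AlgebraicClosure ℚ))) L₃]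
    (hL₃ : Module.finrank ↥(IntermediateField.adjoin ℚ ({β} : Set (AlgebraicClosure ℚ))) L₃ = 8) (θ₃ : L₃)
    (hθ₃ : θ₃ ^ 8 - 8 * θ₃ ^ 6 + 20 * θ₃ ^ 4 - 16 * θ₃ ^ 2 + 2 = 0)
    (hr : (powMonoidHom (α := NarrowClassGroup L₃) 2).range.index = (powMonoidHom (α := NarrowClassGroup L₂) 2).range.index)
    (κ : ZpExtension ℚ 2) (hκ : κ.IsCyclotomic) :
    ∃ (γ : absoluteGaloisGroup ℚ) (Dd : ((⟨0, (p : ℚ), 0, (q : ℚ), (r : ℚ)⟩ : WeierstrassCurve ℚ)).FineSelmerDualData κ γ),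
      Module.Finite ℤ_[2] (RestrictScalars ℤ_[2] (IwasawaAlgebra 2) Dd.X) :=
  conjA_two_cubicModel_of_narrowRank_layer_models_eq p q r hirr hβ 2 (by norm_num) L₂ (by rw [hL₂]; norm_num) θ₂
    (by rw [iterate_sq_sub_two_two]; linear_combination hθ₂) L₃ (by rw [hL₃]; norm_num) θ₃
    (by rw [iterate_sq_sub_two_three]; linear_combination hθ₃) hr κ hκ

/-! ## §3 The Q⁺ road: `FineSelmerConjATwoOrdPosDisc` from a stabilising pair of narrow `2`-ranks per curve -/

/-- ★ **THE Q⁺ ROAD AT ANY RUNG: `FineSelmerConjATwoOrdPosDisc` FROM ONE STABILISING PAIR OF NARROW `2`-RANKS PER CURVE — KERNEL, NO OTHER DATUM.**  If at every curve of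
the cell [non-CM, analytic rank `0`, good ordinary at `2`, `ρ̄_{W,2}` onto, `0 < Δ`] SOME non-zero `P ∈ W[2]` and SOME `m ≥ 1` have
`rank₂ Cl⁺(ℚ(P)_{m+1}) = rank₂ Cl⁺(ℚ(P)_m)` — equal indices `[Cl⁺ : (Cl⁺)²]` at the layers `m` and `m+1` of every cyclotomic `ℤ₂`-extension of the totally real cubic
`ℚ(P) = ℚ̄^{Stab P}` (any `NumberField` instances; concretely the narrow `2`-ranks of `ℚ(P)(θ_m)` and `ℚ(P)(θ_{m+1})`, degrees `3·2^m` and `3·2^{m+1}`) — then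
`FineSelmerConjATwoOrdPosDisc` (the (A)₂-half of G11⁺ = Greenberg's Conj. 1.11 at `2` on the cell).  GEN 10's road is the case `m = 1`; here the rung may vary with the
curve.  Prices Q⁺ as «the narrow `2`-rank of the cubic tower `ℚ(P)_j` stops growing at some consecutive pair `j ≥ 1`» (nothing is asserted about any curve).
[cite: Fukuda1994, Thm. 1 (2), p. 264] [cite: Washington1997, §13.1 and Lemma 13.3] [cite: CoatesSujatha2005, Conj. A] [cite: GreenbergLNM1716, Conj. 1.11 and p. 122] -/
theorem fineSelmerConjATwoOrdPosDisc_of_exists_narrowRank_layer_succ_eq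
    (hIw : ∀ (W : WeierstrassCurve ℚ) [W.IsElliptic] [W.IsGloballyMinimal], ¬ W.HasCM → W.analyticRank = 0 →
      GoodOrd W 2 → W.HasSurjectiveModNGaloisRep 2 → 0 < W.Δ →
      ∃ (P : geomTorsion W 2) (m : ℕ), P ≠ 0 ∧ 1 ≤ m ∧
        ∀ κP : ZpExtension ↥(IntermediateField.fixedField (MulAction.stabilizer (absoluteGaloisGroup ℚ) P)) 2,
          κP.IsCyclotomic → ∀ [NumberField ↥(κP.layer m)] [NumberField ↥(κP.layer (m + 1))],
            (powMonoidHom (α := NarrowClassGroup ↥(κP.layer (m + 1))) 2).range.index =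
              (powMonoidHom (α := NarrowClassGroup ↥(κP.layer m)) 2).range.index) :
    FineSelmerConjATwoOrdPosDisc := by
  intro W _ _ hcm hr hgo h2 hΔ κ hκ
  obtain ⟨P, m, hP, hm, hcert⟩ := hIw W hcm hr hgo h2 hΔ
  have h3 : Module.finrank ℚ ↥(IntermediateField.fixedField (MulAction.stabilizer (absoluteGaloisGroup ℚ) P)) = 3 :=
    finrank_fixedField_stabilizer_eq_three_of_irreducible W (hasIrreducibleModPGaloisRep_of_hasSurjectiveModNGaloisRep W 2 h2) hP
  haveI : FiniteDimensional ℚ ↥(IntermediateField.fixedField (MulAction.stabilizer (absoluteGaloisGroup ℚ) P)) :=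
    finiteDimensional_fixedField_stabilizer W P
  haveI : NumberField ↥(IntermediateField.fixedField (MulAction.stabilizer (absoluteGaloisGroup ℚ) P)) :=
    NumberField.of_module_finite ℚ _
  exact conjA_two_of_narrowRank_layer_succ_eq_pointField W hP h3 m hm hcert κ hκ

/-! ## §4 (GEN 11 append) The two Q⁺ roads — «narrow `μ₂(ℚ(P)) = 0`» (GEN 8) and «a stabilising pair of narrow `2`-ranks» (§3) — consume the SAME datum -/

/-- **For a cubic point field the Kida-lite datum and the rung datum are equivalent** (`W/ℚ` a Weierstrass curve, `P ∈ W[2]`, `[ℚ(P) : ℚ] = 3`): «(a) `μ₂ = 0` for every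
cyclotomic `ℤ₂`-extension `κP` of `ℚ(P)` ∧ (b) `∃ D`, `ord₂ h⁺(ℚ(P)_n) ≤ ord₂ h(ℚ(P)_n) + D` for every `κP` and `n`» ⟺ «`∃ m ≥ 1`,
`[Cl⁺(κP.layer (m+1)) : (Cl⁺)²] = [Cl⁺(κP.layer m) : (Cl⁺)²]` for every `κP`» — the Literature theorem `NarrowFukuda.narrowMu_iff_exists_succ_eq_of_finrank_eq_three` (NARROW FUKUDA
one way; rank monotonicity + `rank₂ Cl⁺ ≤ rank₂ Cl +` narrow defect the other way). [cite: Fukuda1994, Thm. 1 (2), p. 264] [cite: Washington1997, §13.3 Prop. 13.22–13.23]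
[cite: Kida1982JFields, main theorem (μ-part; shape only)] -/
theorem narrowMu_pointField_iff_exists_narrowRank_layer_succ_eq (W : WeierstrassCurve ℚ) {P : geomTorsion W 2}
    (h3 : Module.finrank ℚ ↥(IntermediateField.fixedField (MulAction.stabilizer (absoluteGaloisGroup ℚ) P)) = 3)
    [NumberField ↥(IntermediateField.fixedField (MulAction.stabilizer (absoluteGaloisGroup ℚ) P))] :
    ((∀ κP : ZpExtension ↥(IntermediateField.fixedField (MulAction.stabilizer (absoluteGaloisGroup ℚ) P)) 2,
        κP.IsCyclotomic → ClassicalMuVanishes κP) ∧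
      ∃ D : ℕ, ∀ κP : ZpExtension ↥(IntermediateField.fixedField (MulAction.stabilizer (absoluteGaloisGroup ℚ) P)) 2,
        κP.IsCyclotomic → ∀ n : ℕ, ∀ [NumberField ↥(κP.layer n)],
          padicValNat 2 (narrowClassNumber ↥(κP.layer n)) ≤ padicValNat 2 (classNumber ↥(κP.layer n)) + D) ↔
    ∃ m, 1 ≤ m ∧ ∀ κP : ZpExtension ↥(IntermediateField.fixedField (MulAction.stabilizer (absoluteGaloisGroup ℚ) P)) 2,
      κP.IsCyclotomic → ∀ [NumberField ↥(κP.layer m)] [NumberField ↥(κP.layer (m + 1))],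
        (powMonoidHom (α := NarrowClassGroup ↥(κP.layer (m + 1))) 2).range.index =
          (powMonoidHom (α := NarrowClassGroup ↥(κP.layer m)) 2).range.index :=
  NarrowFukuda.narrowMu_iff_exists_succ_eq_of_finrank_eq_three _ h3

/-- **GEN 8's Q⁺ hypothesis ⟹ §3's Q⁺ hypothesis**: on the cell, a `P ≠ 0` with narrow `μ₂(ℚ(P)) = 0` ((a) ∧ (b)) gives a `P ≠ 0` with a stabilising pair `m ≥ 1` of narrow
`2`-ranks (`[ℚ(P):ℚ] = 3` since `ρ̄_{W,2}` is onto). [cite: Fukuda1994, Thm. 1 (2), p. 264] [cite: Washington1997, §13.3 Prop. 13.22–13.23] [cite: CoatesSujatha2005, Conj. A] -/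
theorem hIw_exists_narrowRank_layer_succ_eq_of_hIw_narrowMu_pointField
    (hIw : ∀ (W : WeierstrassCurve ℚ) [W.IsElliptic] [W.IsGloballyMinimal], ¬ W.HasCM → W.analyticRank = 0 →
      GoodOrd W 2 → W.HasSurjectiveModNGaloisRep 2 → 0 < W.Δ →
      ∃ (P : geomTorsion W 2) (D : ℕ), P ≠ 0 ∧
        (∀ κP : ZpExtension ↥(IntermediateField.fixedField (MulAction.stabilizer (absoluteGaloisGroup ℚ) P)) 2,
          κP.IsCyclotomic → ClassicalMuVanishes κP) ∧
        (∀ κP : ZpExtension ↥(IntermediateField.fixedField (MulAction.stabilizer (absoluteGaloisGroup ℚ) P)) 2,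
          κP.IsCyclotomic → ∀ n : ℕ,
          ∀ [NumberField ↥(κP.layer n)],
          padicValNat 2 (narrowClassNumber ↥(κP.layer n)) ≤ padicValNat 2 (classNumber ↥(κP.layer n)) + D))
    (W : WeierstrassCurve ℚ) [W.IsElliptic] [W.IsGloballyMinimal] (hcm : ¬ W.HasCM) (hr : W.analyticRank = 0)
    (hgo : GoodOrd W 2) (h2 : W.HasSurjectiveModNGaloisRep 2) (hΔ : 0 < W.Δ) :
    ∃ (P : geomTorsion W 2) (m : ℕ), P ≠ 0 ∧ 1 ≤ m ∧
      ∀ κP : ZpExtension ↥(IntermediateField.fixedField (MulAction.stabilizer (absoluteGaloisGroup ℚ) P)) 2,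
        κP.IsCyclotomic → ∀ [NumberField ↥(κP.layer m)] [NumberField ↥(κP.layer (m + 1))],
          (powMonoidHom (α := NarrowClassGroup ↥(κP.layer (m + 1))) 2).range.index =
            (powMonoidHom (α := NarrowClassGroup ↥(κP.layer m)) 2).range.index := by
  -- (`rcases`/`obtain` on these binder-heavy statements is pathologically slow here; destructure by `Exists.elim` and projections)
  refine (hIw W hcm hr hgo h2 hΔ).elim fun P hD => hD.elim fun D hPD => ?_
  have hP : P ≠ 0 := hPD.1
  have h3 : Module.finrank ℚ ↥(IntermediateField.fixedField (MulAction.stabilizer (absoluteGaloisGroup ℚ) P)) = 3 :=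
    finrank_fixedField_stabilizer_eq_three_of_irreducible W (hasIrreducibleModPGaloisRep_of_hasSurjectiveModNGaloisRep W 2 h2) hP
  haveI : FiniteDimensional ℚ ↥(IntermediateField.fixedField (MulAction.stabilizer (absoluteGaloisGroup ℚ) P)) :=
    finiteDimensional_fixedField_stabilizer W P
  haveI : NumberField ↥(IntermediateField.fixedField (MulAction.stabilizer (absoluteGaloisGroup ℚ) P)) :=
    NumberField.of_module_finite ℚ _
  exact ((narrowMu_pointField_iff_exists_narrowRank_layer_succ_eq W h3).mp ⟨hPD.2.1, D, hPD.2.2⟩).elim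
    fun m hm => ⟨P, m, hP, hm.1, hm.2⟩

/-- **§3's Q⁺ hypothesis ⟹ GEN 8's Q⁺ hypothesis**: on the cell, a `P ≠ 0` with a stabilising pair `m ≥ 1` of narrow `2`-ranks gives narrow `μ₂(ℚ(P)) = 0` ((a) ∧ (b)).
[cite: Fukuda1994, Thm. 1 (2), p. 264] [cite: Washington1997, §13.3 Prop. 13.22–13.23] [cite: CoatesSujatha2005, Conj. A] -/
theorem hIw_narrowMu_pointField_of_hIw_exists_narrowRank_layer_succ_eq
    (hIw : ∀ (W : WeierstrassCurve ℚ) [W.IsElliptic] [W.IsGloballyMinimal], ¬ W.HasCM → W.analyticRank = 0 →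
      GoodOrd W 2 → W.HasSurjectiveModNGaloisRep 2 → 0 < W.Δ →
      ∃ (P : geomTorsion W 2) (m : ℕ), P ≠ 0 ∧ 1 ≤ m ∧
        ∀ κP : ZpExtension ↥(IntermediateField.fixedField (MulAction.stabilizer (absoluteGaloisGroup ℚ) P)) 2,
          κP.IsCyclotomic → ∀ [NumberField ↥(κP.layer m)] [NumberField ↥(κP.layer (m + 1))],
            (powMonoidHom (α := NarrowClassGroup ↥(κP.layer (m + 1))) 2).range.index =
              (powMonoidHom (α := NarrowClassGroup ↥(κP.layer m)) 2).range.index)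
    (W : WeierstrassCurve ℚ) [W.IsElliptic] [W.IsGloballyMinimal] (hcm : ¬ W.HasCM) (hr : W.analyticRank = 0)
    (hgo : GoodOrd W 2) (h2 : W.HasSurjectiveModNGaloisRep 2) (hΔ : 0 < W.Δ) :
    ∃ (P : geomTorsion W 2) (D : ℕ), P ≠ 0 ∧
      (∀ κP : ZpExtension ↥(IntermediateField.fixedField (MulAction.stabilizer (absoluteGaloisGroup ℚ) P)) 2,
        κP.IsCyclotomic → ClassicalMuVanishes κP) ∧
      (∀ κP : ZpExtension ↥(IntermediateField.fixedField (MulAction.stabilizer (absoluteGaloisGroup ℚ) P)) 2,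
        κP.IsCyclotomic → ∀ n : ℕ,
        ∀ [NumberField ↥(κP.layer n)],
        padicValNat 2 (narrowClassNumber ↥(κP.layer n)) ≤ padicValNat 2 (classNumber ↥(κP.layer n)) + D) := by
  refine (hIw W hcm hr hgo h2 hΔ).elim fun P hm => hm.elim fun m hPm => ?_
  have hP : P ≠ 0 := hPm.1
  have h3 : Module.finrank ℚ ↥(IntermediateField.fixedField (MulAction.stabilizer (absoluteGaloisGroup ℚ) P)) = 3 :=
    finrank_fixedField_stabilizer_eq_three_of_irreducible W (hasIrreducibleModPGaloisRep_of_hasSurjectiveModNGaloisRep W 2 h2) hP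
  haveI : FiniteDimensional ℚ ↥(IntermediateField.fixedField (MulAction.stabilizer (absoluteGaloisGroup ℚ) P)) :=
    finiteDimensional_fixedField_stabilizer W P
  haveI : NumberField ↥(IntermediateField.fixedField (MulAction.stabilizer (absoluteGaloisGroup ℚ) P)) :=
    NumberField.of_module_finite ℚ _
  have key := (narrowMu_pointField_iff_exists_narrowRank_layer_succ_eq W h3).mpr ⟨m, hPm.2.1, hPm.2.2⟩
  exact key.2.elim fun D hδ => ⟨P, D, hP, key.1, hδ⟩

/-- ★ **THE TWO Q⁺ ROADS ARE ONE.**  The hypothesis of GEN 8's `NarrowMu.fineSelmerConjATwoOrdPosDisc_of_narrowMu_pointField` (at every curve of the cell some `P ∈ W[2] ∖ 0` with narrow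
`μ₂(ℚ(P)) = 0`: (a) ∧ (b) with a uniform `D`) and the hypothesis of `fineSelmerConjATwoOrdPosDisc_of_exists_narrowRank_layer_succ_eq` (§3: at every curve some `P ≠ 0` and some rung
`m ≥ 1` with `rank₂ Cl⁺(ℚ(P)_{m+1}) = rank₂ Cl⁺(ℚ(P)_m)` along every cyclotomic `ℤ₂`-extension) are EQUIVALENT.  One road into Q⁺, priced as «narrow `μ(X⁺(ℚ(P)_∞)) = 0`» = «the narrow
`2`-rank of the cubic tower stops growing at some consecutive pair» (nothing asserted about any curve). [cite: Fukuda1994, Thm. 1 (2), p. 264] [cite: Washington1997, §13.3 Prop. 13.22–13.23]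
[cite: CoatesSujatha2005, Conj. A] [cite: GreenbergLNM1716, Conj. 1.11 and p. 122] -/
theorem hIw_narrowMu_pointField_iff_hIw_exists_narrowRank_layer_succ_eq :
    (∀ (W : WeierstrassCurve ℚ) [W.IsElliptic] [W.IsGloballyMinimal], ¬ W.HasCM → W.analyticRank = 0 →
      GoodOrd W 2 → W.HasSurjectiveModNGaloisRep 2 → 0 < W.Δ →
      ∃ (P : geomTorsion W 2) (D : ℕ), P ≠ 0 ∧
        (∀ κP : ZpExtension ↥(IntermediateField.fixedField (MulAction.stabilizer (absoluteGaloisGroup ℚ) P)) 2,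
          κP.IsCyclotomic → ClassicalMuVanishes κP) ∧
        (∀ κP : ZpExtension ↥(IntermediateField.fixedField (MulAction.stabilizer (absoluteGaloisGroup ℚ) P)) 2,
          κP.IsCyclotomic → ∀ n : ℕ,
          ∀ [NumberField ↥(κP.layer n)],
          padicValNat 2 (narrowClassNumber ↥(κP.layer n)) ≤ padicValNat 2 (classNumber ↥(κP.layer n)) + D)) ↔
    (∀ (W : WeierstrassCurve ℚ) [W.IsElliptic] [W.IsGloballyMinimal], ¬ W.HasCM → W.analyticRank = 0 →
      GoodOrd W 2 → W.HasSurjectiveModNGaloisRep 2 → 0 < W.Δ →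
      ∃ (P : geomTorsion W 2) (m : ℕ), P ≠ 0 ∧ 1 ≤ m ∧
        ∀ κP : ZpExtension ↥(IntermediateField.fixedField (MulAction.stabilizer (absoluteGaloisGroup ℚ) P)) 2,
          κP.IsCyclotomic → ∀ [NumberField ↥(κP.layer m)] [NumberField ↥(κP.layer (m + 1))],
            (powMonoidHom (α := NarrowClassGroup ↥(κP.layer (m + 1))) 2).range.index =
              (powMonoidHom (α := NarrowClassGroup ↥(κP.layer m)) 2).range.index) :=
  ⟨fun hIw W _ _ hcm hr hgo h2 hΔ => hIw_exists_narrowRank_layer_succ_eq_of_hIw_narrowMu_pointField hIw W hcm hr hgo h2 hΔ,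
    fun hIw W _ _ hcm hr hgo h2 hΔ => hIw_narrowMu_pointField_of_hIw_exists_narrowRank_layer_succ_eq hIw W hcm hr hgo h2 hΔ⟩


/-! ## §5 (GEN 11 append) The rung `m` with an EXPLICIT Fukuda index (covers `m = 0`: index `0` by a tree certificate) -/

/-- **(A) at `2` for `y² = x³ + px² + qx + r` (irreducible, `β` a root) from ONE equality `rank₂ Cl⁺(ℚ(β)_{m+1}) = rank₂ Cl⁺(ℚ(β)_m)` at ANY rung `m ≥ 0`, given Fukuda index
`≤ m` for every cyclotomic `ℤ₂`-extension of `ℚ(β)`** (abstract layers; NO bound `B` displayed).  For `m ≥ 1` the index hypothesis is automatic (cubic field,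
`conjA_two_cubicModel_of_narrowRank_layer_succ_eq`); for `m = 0` it is Fukuda index `0`, certified in the tree by `forall_totallyRamifiedFrom_zero_of_not_dvd_discr` (`2 ∤ d`) or
`totallyRamifiedFrom_zero_of_evenIndexCertificate` — GEN 9's rung-`0` door `NarrowRankCert.conjA_two_cubicModel_of_narrowRankCertificate … 0 B` without the `B`.
[cite: Fukuda1994, Thm. 1 (2), p. 264] [cite: Washington1997, §13.1 and Lemma 13.3] [cite: CoatesSujatha2005, Conj. A and Thm. 3.4] -/
theorem conjA_two_cubicModel_of_index_le_of_narrowRank_layer_succ_eq (p q r : ℤ)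
    [((⟨0, (p : ℚ), 0, (q : ℚ), (r : ℚ)⟩ : WeierstrassCurve ℚ)).IsElliptic]
    (hirr : Irreducible (Cubic.toPoly ⟨1, (p : ℚ), q, r⟩))
    {β : AlgebraicClosure ℚ} (hβ : aeval β (Cubic.toPoly ⟨1, (p : ℚ), q, r⟩) = 0)
    [NumberField ↥(IntermediateField.adjoin ℚ ({β} : Set (AlgebraicClosure ℚ)))]
    (m : ℕ)
    (hidx : ∀ κP : ZpExtension ↥(IntermediateField.adjoin ℚ ({β} : Set (AlgebraicClosure ℚ))) 2, κP.IsCyclotomic → TotallyRamifiedFrom κP m)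
    (hcert : ∀ κP : ZpExtension ↥(IntermediateField.adjoin ℚ ({β} : Set (AlgebraicClosure ℚ))) 2, κP.IsCyclotomic →
      ∀ [NumberField ↥(κP.layer m)] [NumberField ↥(κP.layer (m + 1))],
        (powMonoidHom (α := NarrowClassGroup ↥(κP.layer (m + 1))) 2).range.index =
          (powMonoidHom (α := NarrowClassGroup ↥(κP.layer m)) 2).range.index)
    (κ : ZpExtension ℚ 2) (hκ : κ.IsCyclotomic) :
    ∃ (γ : absoluteGaloisGroup ℚ) (Dd : ((⟨0, (p : ℚ), 0, (q : ℚ), (r : ℚ)⟩ : WeierstrassCurve ℚ)).FineSelmerDualData κ γ),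
      Module.Finite ℤ_[2] (RestrictScalars ℤ_[2] (IwasawaAlgebra 2) Dd.X) := by
  obtain ⟨hμ, D, hδ⟩ := NarrowFukuda.narrowMu_of_index_le_of_succ_eq
    (↥(IntermediateField.adjoin ℚ ({β} : Set (AlgebraicClosure ℚ)))) m hidx hcert
  exact NarrowMu.conjA_two_cubicModel_of_narrowMu p q r hirr hβ hμ D hδ κ hκ

/-- **The rung `m = 0` for `2 ∤ disc ℚ(β)`** (index `0` by `forall_totallyRamifiedFrom_zero_of_not_dvd_discr`): `rank₂ Cl⁺(ℚ(β)_1) = rank₂ Cl⁺(ℚ(β)_0)` (abstract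
layers; concretely `ℚ(β)(√2)` vs `ℚ(β)`) ⟹ (A)₂, no bound `B`. [cite: Fukuda1994, Thm. 1 (2), p. 264] [cite: Washington1997, §13.1] [cite: CoatesSujatha2005, Conj. A and Thm. 3.4] -/
theorem conjA_two_cubicModel_of_not_dvd_discr_of_narrowRank_layer_one_eq (p q r : ℤ)
    [((⟨0, (p : ℚ), 0, (q : ℚ), (r : ℚ)⟩ : WeierstrassCurve ℚ)).IsElliptic]
    (hirr : Irreducible (Cubic.toPoly ⟨1, (p : ℚ), q, r⟩))
    {β : AlgebraicClosure ℚ} (hβ : aeval β (Cubic.toPoly ⟨1, (p : ℚ), q, r⟩) = 0)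
    [NumberField ↥(IntermediateField.adjoin ℚ ({β} : Set (AlgebraicClosure ℚ)))]
    (hd : ¬ (2 : ℤ) ∣ NumberField.discr ↥(IntermediateField.adjoin ℚ ({β} : Set (AlgebraicClosure ℚ))))
    (hcert : ∀ κP : ZpExtension ↥(IntermediateField.adjoin ℚ ({β} : Set (AlgebraicClosure ℚ))) 2, κP.IsCyclotomic →
      ∀ [NumberField ↥(κP.layer 0)] [NumberField ↥(κP.layer (0 + 1))],
        (powMonoidHom (α := NarrowClassGroup ↥(κP.layer (0 + 1))) 2).range.index =
          (powMonoidHom (α := NarrowClassGroup ↥(κP.layer 0)) 2).range.index)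
    (κ : ZpExtension ℚ 2) (hκ : κ.IsCyclotomic) :
    ∃ (γ : absoluteGaloisGroup ℚ) (Dd : ((⟨0, (p : ℚ), 0, (q : ℚ), (r : ℚ)⟩ : WeierstrassCurve ℚ)).FineSelmerDualData κ γ),
      Module.Finite ℤ_[2] (RestrictScalars ℤ_[2] (IwasawaAlgebra 2) Dd.X) := by
  have hmonic : (Cubic.toPoly ⟨1, (p : ℚ), q, r⟩).Monic := Cubic.monic_of_a_eq_one rfl
  have hβint : IsIntegral ℚ β := ⟨_, hmonic, by rwa [← aeval_def]⟩
  have h3 : Module.finrank ℚ ↥(IntermediateField.adjoin ℚ ({β} : Set (AlgebraicClosure ℚ))) = 3 := by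
    rw [IntermediateField.adjoin.finrank hβint, ← minpoly.eq_of_irreducible_of_monic hirr hβ hmonic]
    exact Cubic.natDegree_of_a_ne_zero' one_ne_zero
  have hK : ¬ 2 ∣ Module.finrank ℚ ↥(IntermediateField.adjoin ℚ ({β} : Set (AlgebraicClosure ℚ))) := by rw [h3]; decide
  exact conjA_two_cubicModel_of_index_le_of_narrowRank_layer_succ_eq p q r hirr hβ 0
    (forall_totallyRamifiedFrom_zero_of_not_dvd_discr hK hd) hcert κ hκ

end Summit.BirchSwinnertonDyer.BirchSwinnertonDyer.Theorems.SteinbergFibreAtTwo.NarrowRankRung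

end
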